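import Summits.HodgeConjecture.CorCM.SexticTetradecicWeilRealised
import Summits.HodgeConjecture.CorCM.MultiFieldWeilFrames
import Summits.HodgeConjecture.CorCM.MultiFieldWeilHodge
import Summits.HodgeConjecture.CorCM.MultiFieldWeilMarkman
import Summits.HodgeConjecture.CorCM.SexticDecicWeilHodgeOfMarkman
import HarnessLib

/-!
# COR-CM — `E × T × B₇` over a SEXTIC and a TETRADECIC CM field sharing `k`: the Hodge conjecture for every product of copies of `E`, a `(1,2)`-threefold `T` over ANY sextic
# CM field and a CM sevenfold `B₇` over ANY tetradecic CM field with ANY type not induced from `k` — GIVEN Markman's fourfold theorem and the Weil space of the ONE abelian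
# variety `B₇ × E^{7−2q}` of Weil type; NO hypothesis on the fields

Cell `pub-hodgecm2` (COR-CM), seat b30 gen 29 (2026-08-24); count-neutral own lane (stem `SexticTetradecicWeil*`), capstone of `CorCM/SexticTetradecicWeilRealised.lean`; the
first HEADLINE produced entirely by the generic engine + census toolkit (no instance census file).  Theorems only; no definition, no named fact of its own, no `sorry`.
HONEST FRAMING: `HC_CM` is NOT proved and not asserted.  Displayed inputs: the named fact `Markman2025_weilClasses_algebraic_abelianFourfold` (the Weil plane of `T × E`) and the
HYPOTHESIS `hW₇` — the Weil space of `B₇ ⊞ E^{7−2q}` (a `(14−2q)`-dimensional abelian variety of Weil type for `k`), which is OPEN: nothing in the tree or in print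
discharges it.  Read as a census theorem: the Hodge rings of all `E^a × T^n × B₇^m` are generated by divisors, the Weil classes of `T × E` and those of `B₇ × E^{7−2q}`.

* §1 frame form **`hodgeConjectureFor_biproduct_comp_of_frames27`** (+ dominated);
* §2 family form WITHOUT frames **`hodgeConjectureFor_biproduct_comp27`**: the frames come from `MultiFieldWeil.exists_signFrame` (degree `14`, NEW: any degree) read at the
  position set the frame defines (`mem_iff_snd_eq_decide_mem_posSet` — no normal form for the `35 + 21 + 7` types) and `SexticOcticWeil.exists_frame_fin` (sextic);
  hypotheses: `[K₁:ℚ] = 6`, `[K₇:ℚ] = 14`, one member of `Φ_T` over `τ`, `q ∈ {1, 2, 3}` members of `Φ_{B₇}` over `τ` (the conjugate structure covers `q ∈ {4,5,6}`), `hW4`, `hW₇`.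
[cite: Markman2025SurveySecant, Thm. 1.2] [cite: Pohlmann1968, Thm 1] [cite: Milne2020HodgeClassesAV, 1.2 (a) and Thm. 1] [cite: MoonenZarhin1995Duke, Thm. 2.4]
[cite: DixonMortimer1996, §2.1] [cite: MumfordAV1970, §19]

## References
* [Markman2025SurveySecant] E. Markman, arXiv:2509.23403, Thm. 1.2.  [Pohlmann1968] H. Pohlmann, Ann. of Math. 88 (1968), Thm 1.  [Milne2020HodgeClassesAV] J. S. Milne,
  arXiv:2010.08857, 1.2 (a), Thm. 1.  [MoonenZarhin1995Duke] B. Moonen, Yu. Zarhin, Duke Math. J. 77 (1995), Thm. 2.4.  [DixonMortimer1996] J. D. Dixon, B. Mortimer,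
  *Permutation Groups*, GTM 163, §2.1.  [MumfordAV1970] D. Mumford, *Abelian Varieties*, §19.
-/

noncomputable section

open CategoryTheory CategoryTheory.Limits NumberField

namespace Summit.HodgeConjecture.CorCM.SexticTetradecicWeil

open Literature.AlgebraicGeometry Literature.AlgebraicGeometry.Motives Literature.AlgebraicGeometry.HodgeTheory
open Literature.AlgebraicGeometry.ComplexMultiplication (IsCMTypeRealisation)
open Literature.AlgebraicGeometry.Pohlmann1968
open Literature.AlgebraicTopology.SingularHomology
open Literature.NumberTheory.ComplexMultiplication
open Summit.HodgeConjecture.CorCM.Census.MultiFieldWeil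
open Summit.HodgeConjecture.CorCM.MultiFieldWeil
open Summit.HodgeConjecture.CorCM.SexticOcticWeil (exists_frame_fin card_filter_comp_eq_of_finrank)

open scoped Classical

/-! ## §1 The frame form -/

section Frames

variable {I : Type} {Kf : I → Type} [∀ i, Field (Kf i)] [∀ i, NumberField (Kf i)] [∀ i, IsCMField (Kf i)]
  {i₀ : I} {is : Fin 2 → I} {τ : Kf i₀ →+* ℂ}
  {A : Fin (2 + 1) → AbelianVariety ℂ} {Φ : ∀ j : Fin (2 + 1), CMType (Kf (mfSlots i₀ is j))}
  {ι : ∀ j, 𝓞 (Kf (mfSlots i₀ is j)) →+* End (A j)}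
  {θ : ∀ j, Kf (mfSlots i₀ is j) →+* Module.End ℂ (complexBetti (A j).X 1)}

/-- **MAIN THEOREM (frame form).  The Hodge conjecture for every product of copies `⨁_j A(κ j)` of `E, T, B₇`**, for `E = A 0 ⊨ (k; {τ})`, `T = A 1 ⊨ (K₁; Φ 1)` over a SEXTIC
`K₁ ⊇ i₁(k)` (one member over `τ`, position `0` of `e₁`), `B₇ = A 2 ⊨ (K₇; Φ 2)` over a TETRADECIC `K₇ ⊇ i₇(k)` (type read by `e₇` at a set `Q` of `q` positions, `0 < q`, `2q < 7`),
GIVEN Markman's fourfold theorem (`T × E`) and the Weil space `hW₇` of `B₇ ⊞ E^{7−2q}`; NO hypothesis on the fields.  `HC_CM` is NOT asserted.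
[cite: Markman2025SurveySecant, Thm. 1.2] [cite: Pohlmann1968, Thm 1] [cite: Milne2020HodgeClassesAV, 1.2 (a) and Thm. 1] -/
theorem hodgeConjectureFor_biproduct_comp_of_frames27 (hW4 : Markman2025_weilClasses_algebraic_abelianFourfold)
    {N : ℕ} (κ : Fin N → Fin (2 + 1)) (h6 : Module.finrank ℚ (Kf (is 0)) = 6) (h2 : Module.finrank ℚ (Kf i₀) = 2)
    (i₁ : Kf i₀ →+* Kf (is 0)) (i₇ : Kf i₀ →+* Kf (is 1))
    {δ : 𝓞 (Kf i₀)} {d : ℕ} (hd : 0 < d) (hδ : ((δ : Kf i₀)) ^ 2 = -(d : Kf i₀)) (hτ : τ (δ : Kf i₀) = Complex.I * (Real.sqrt d : ℂ))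
    (hA : ∀ j, IsCMTypeRealisation (Φ j) (A j) (ι j) (θ j))
    (e₁ : (Kf (is 0) →+* ℂ) ≃ Fin 3 × Bool) (e₇ : (Kf (is 1) →+* ℂ) ≃ Fin 7 × Bool)
    (he₁_sign : ∀ s, (e₁ s).2 = true ↔ s.comp i₁ = τ) (he₇_sign : ∀ s, (e₇ s).2 = true ↔ s.comp i₇ = τ)
    (he₁_conj : ∀ s, e₁ (ComplexEmbedding.conjugate s) = ((e₁ s).1, !(e₁ s).2))
    (he₇_conj : ∀ s, e₇ (ComplexEmbedding.conjugate s) = ((e₇ s).1, !(e₇ s).2))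
    (hΨ : ∀ σ : Kf i₀ →+* ℂ, σ ∈ (Φ 0).1 ↔ σ = τ)
    (hΦ₁ : ∀ s : Kf (is 0) →+* ℂ, s ∈ (Φ 1).1 ↔ (e₁ s).2 = decide ((e₁ s).1 = 0))
    {Q : Finset (Fin 7)} (hΦ₇ : ∀ s : Kf (is 1) →+* ℂ, s ∈ (Φ 2).1 ↔ (e₇ s).2 = decide ((e₇ s).1 ∈ Q))
    {q : ℕ} (hQ : Q.card = q) (hq0 : 0 < q) (hq : 2 * q < 7)
    (hW₇ : weilClassesOf (⨁ fun i => A (partSlots (7 - 2 * q) 1 i))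
      (biproduct.map fun i => ι (partSlots (7 - 2 * q) 1 i) (δfam (im27 is i₁ i₇) δ (partSlots (7 - 2 * q) 1 i))) (7 - q) d ≤
      algebraicClasses (⨁ fun i => A (partSlots (7 - 2 * q) 1 i)).X (7 - q)) :
    HodgeConjectureFor (⨁ fun j => A (κ j)).dim (⨁ fun j => A (κ j)).X := by
  have hW : ∀ m : Fin 2, weilClassesOf (⨁ fun i => A (partSlots (c27 q m) m i))
      (biproduct.map fun i => ι (partSlots (c27 q m) m i) (δfam (im27 is i₁ i₇) δ (partSlots (c27 q m) m i))) (w27 q m) d ≤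
      algebraicClasses (⨁ fun i => A (partSlots (c27 q m) m i)).X (w27 q m) := by
    intro m
    refine Fin.cases ?_ (fun m => Fin.cases ?_ (fun m => m.elim0) m) m
    · exact weilHyp_of_markman_fourfold (im := im27 is i₁ i₇) hW4 0 h6 h2 hd hδ hA e₁ he₁_sign hΦ₁ hΨ
    · exact hW₇
  exact hodgeConjectureFor_biproduct_comp_of_defectLawG (is := is) (P27 Q) (c27 q) (w27 q) (n27_add_c27 hq) (c27_lt_n27 hq0) κ h2 (im27 is i₁ i₇) hτ hA
    (e27 is e₁ e₇) (he27_sign (is := is) he₁_sign he₇_sign) (he27_conj (is := is) he₁_conj he₇_conj) hΨ (hΦ27 (is := is) hΦ₁ hΦ₇)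
    (fun v T hT => exists_hasDefectsG_realisedTuples27 (is := is) he₁_sign he₇_sign hQ hq0 hq v T hT) hW

/-! ## §2 The family form without frames -/

/-- **MAIN THEOREM (no frames).  `E = A 0 ⊨ (k; Ψ ∋ τ)` the CM curve of the imaginary quadratic `k`, `T = A 1 ⊨ (K₁; Φ₁)` over ANY SEXTIC CM field `K₁ ⊇ i₁(k)` with ONE member of
`Φ₁` over `τ`, `B₇ = A 2 ⊨ (K₇; Φ₇)` over ANY TETRADECIC CM field `K₇ ⊇ i₇(k)` (`[K₇:ℚ] = 14`) with `q ∈ {1,2,3}` members of `Φ₇` over `τ` (ANY such type — `35 + 21 + 7` of them; the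
conjugate structure covers `q ∈ {4,5,6}`): the Hodge conjecture for EVERY product of copies `⨁_j A(κ j)`, GIVEN Markman's fourfold theorem and the Weil space of `B₇ ⊞ E^{7−2q}`
(`hW₇`, for a chosen `δ ∈ 𝓞_k`, `δ² = −d`, `τ(δ) = i√d`).**  The tetradecic frame is `MultiFieldWeil.exists_signFrame` read at the position set it defines.  NO hypothesis on the
fields; `HC_CM` is NOT asserted. [cite: Markman2025SurveySecant, Thm. 1.2] [cite: Pohlmann1968, Thm 1] [cite: MoonenZarhin1995Duke, Thm. 2.4] [cite: DixonMortimer1996, §2.1] -/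
theorem hodgeConjectureFor_biproduct_comp27 (hW4 : Markman2025_weilClasses_algebraic_abelianFourfold)
    {N : ℕ} (κ : Fin N → Fin (2 + 1)) (h6 : Module.finrank ℚ (Kf (is 0)) = 6) (h14 : Module.finrank ℚ (Kf (is 1)) = 14) (h2 : Module.finrank ℚ (Kf i₀) = 2)
    (i₁ : Kf i₀ →+* Kf (is 0)) (i₇ : Kf i₀ →+* Kf (is 1))
    {δ : 𝓞 (Kf i₀)} {d : ℕ} (hd : 0 < d) (hδ : ((δ : Kf i₀)) ^ 2 = -(d : Kf i₀)) (hτ : τ (δ : Kf i₀) = Complex.I * (Real.sqrt d : ℂ))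
    (hA : ∀ j, IsCMTypeRealisation (Φ j) (A j) (ι j) (θ j))
    (hΨ : ∀ σ : Kf i₀ →+* ℂ, σ ∈ (Φ 0).1 ↔ σ = τ)
    (h11 : (Finset.univ.filter fun s : Kf (is 0) →+* ℂ => s.comp i₁ = τ ∧ s ∈ (Φ 1).1).card = 1)
    {q : ℕ} (hq7 : (Finset.univ.filter fun s : Kf (is 1) →+* ℂ => s.comp i₇ = τ ∧ s ∈ (Φ 2).1).card = q) (hq0 : 0 < q) (hq : 2 * q < 7)
    (hW₇ : weilClassesOf (⨁ fun i => A (partSlots (7 - 2 * q) 1 i))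
      (biproduct.map fun i => ι (partSlots (7 - 2 * q) 1 i) (δfam (im27 is i₁ i₇) δ (partSlots (7 - 2 * q) 1 i))) (7 - q) d ≤
      algebraicClasses (⨁ fun i => A (partSlots (7 - 2 * q) 1 i)).X (7 - q)) :
    HodgeConjectureFor (⨁ fun j => A (κ j)).dim (⨁ fun j => A (κ j)).X := by
  have hττ : ComplexEmbedding.conjugate τ ≠ τ := QuarticCM.conjugate_ne τ
  have hk : ∀ σ : Kf i₀ →+* ℂ, σ = τ ∨ σ = ComplexEmbedding.conjugate τ := fun σ => QuarticCM.eq_or_eq_conjugate_of_quadratic h2 τ σ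
  obtain ⟨e₁, he₁_sign, he₁_conj, hΦ₁⟩ := exists_frame_fin (n := 2) i₁ hττ hk (card_filter_comp_eq_of_finrank (n := 3) i₁ h6 h2 τ) (Φ 1) h11
  obtain ⟨e₇, he₇_sign, he₇_conj⟩ := exists_signFrame (n := 7) (by rw [h14]) h2 i₇ hττ hk
  have hΦ₇ := mem_iff_snd_eq_decide_mem_posSet he₇_conj (Φ 2)
  have hQ := (card_posSet he₇_sign (Φ 2)).trans hq7
  exact hodgeConjectureFor_biproduct_comp_of_frames27 hW4 κ h6 h2 i₁ i₇ hd hδ hτ hA e₁ e₇ he₁_sign he₇_sign he₁_conj he₇_conj hΨ hΦ₁ hΦ₇ hQ hq0 hq hW₇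

/-- **… and for every abelian variety DOMINATED by such a product** (isogeny images, abelian subvarieties, quotients). `HC_CM` is NOT asserted. [cite: MumfordAV1970, §19]
[cite: Markman2025SurveySecant, Thm. 1.2] [cite: Pohlmann1968, Thm 1] -/
theorem hodgeConjectureFor_of_avDominatedBy_comp27 (hW4 : Markman2025_weilClasses_algebraic_abelianFourfold)
    {N : ℕ} (κ : Fin N → Fin (2 + 1)) (h6 : Module.finrank ℚ (Kf (is 0)) = 6) (h14 : Module.finrank ℚ (Kf (is 1)) = 14) (h2 : Module.finrank ℚ (Kf i₀) = 2)
    (i₁ : Kf i₀ →+* Kf (is 0)) (i₇ : Kf i₀ →+* Kf (is 1))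
    {δ : 𝓞 (Kf i₀)} {d : ℕ} (hd : 0 < d) (hδ : ((δ : Kf i₀)) ^ 2 = -(d : Kf i₀)) (hτ : τ (δ : Kf i₀) = Complex.I * (Real.sqrt d : ℂ))
    (hA : ∀ j, IsCMTypeRealisation (Φ j) (A j) (ι j) (θ j))
    (hΨ : ∀ σ : Kf i₀ →+* ℂ, σ ∈ (Φ 0).1 ↔ σ = τ)
    (h11 : (Finset.univ.filter fun s : Kf (is 0) →+* ℂ => s.comp i₁ = τ ∧ s ∈ (Φ 1).1).card = 1)
    {q : ℕ} (hq7 : (Finset.univ.filter fun s : Kf (is 1) →+* ℂ => s.comp i₇ = τ ∧ s ∈ (Φ 2).1).card = q) (hq0 : 0 < q) (hq : 2 * q < 7)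
    (hW₇ : weilClassesOf (⨁ fun i => A (partSlots (7 - 2 * q) 1 i))
      (biproduct.map fun i => ι (partSlots (7 - 2 * q) 1 i) (δfam (im27 is i₁ i₇) δ (partSlots (7 - 2 * q) 1 i))) (7 - q) d ≤
      algebraicClasses (⨁ fun i => A (partSlots (7 - 2 * q) 1 i)).X (7 - q))
    {X : AbelianVariety ℂ} (hX : Domination.AVDominatedBy X (⨁ fun j => A (κ j))) : HodgeConjectureFor X.dim X.X :=
  Domination.hodgeConjectureFor_of_avDominatedBy
    (hodgeConjectureFor_biproduct_comp27 hW4 κ h6 h14 h2 i₁ i₇ hd hδ hτ hA hΨ h11 hq7 hq0 hq hW₇) hX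

end Frames

end Summit.HodgeConjecture.CorCM.SexticTetradecicWeil

end
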